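import Summits.ValiantsHypothesis.ValiantsHypothesis.Theorems.KPlusLogSqLawTridiagonalRealStaticPumpIter

/-!
# Route «KPlusLogSqLaw», crux `WeakLifting` (stmt-ValiantsHypothesis-19561) — REAL side of the tridiagonal sector:
# HARVESTING THE PUMP, part 1 (orientation `ρ = 1`): one more hierarchical edge at the junction of the two clusters

HONEST FRAMING.  Helper (`--supports stmt-ValiantsHypothesis-19561 --as helper`), seat val-sym-lift-p1 (g12), cell `pub-symmetroid`,
2026-08-27.  Continuation of `…PumpIter`: after `k` pump moves the two top continuants carry anti-aligned certified clusters (`|R| + 2`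
alternations of `D_{k+3}` on one side, `|T| + 2` of `D_{k+4}` on the other, `|R| + |T| = 2k + 1`).  The HARVEST of val-sym-lift-p3 g9
(memo HIERARCHICAL-LIMIT-GAME-liftp3g9.md §3: one macroscopic switch collects both clusters) is ONE more hierarchical edge switching at the
junction `M`: `pump_harvest_pos` treats the states in actual coordinates (`ρ = 1`, `μ = −s`): an edge of type II (vertex `X^L`, link
`√κ·X⁰`, from `exists_move_signs_sep`) switching between `M` and a fresh point `M⁺` makes `D_{k+5}` follow `−D_{k+3}` on `x₁ … M` and `D_{k+4}`
from `M⁺` on, with the transition zero in between: `|R| + |T| + 4` certified alternations along `x₁ :: R ++ M :: M⁺ :: T ++ [y]`.  Also: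
threshold-free forms of the two move lemmas and list bookkeeping.  The reflected orientation and the assembly are in `…PumpHarvestNeg`,
the matrices in `…Pump`.  Nothing here is an upper bound; nothing bears on `WeakLifting` / `TropicalB` in their windows, Conjecture B, the
doors, `MatrixDescartes` (stmt-18050) or VP ≠ VNP.  [mechanism: val-sym-lift-p3 g9's pump-and-harvest; folklore analysis]
-/

-- `Summit.ValiantsHypothesis.ValiantsHypothesis.…` repeats a component by the D-0017 layout (single-conjunct summit); the name is mandated.
set_option linter.dupNamespace false
set_option autoImplicit false

namespace Summit.ValiantsHypothesis.ValiantsHypothesis.Theorems.KPlusLogSqLaw.StaticTridiagonalRealLadder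

open Polynomial
open Summit.ValiantsHypothesis.ValiantsHypothesis.Theorems.ValuativeFlip (ctK ctPath ctPath_apply ctK_zero ctK_one ctK_add_two)
open Summit.ValiantsHypothesis.ValiantsHypothesis.Theorems.KPlusLogSqLaw.StaticTridiagonalRealExcess (exists_move_signs)

/-! ### Threshold-free move lemmas and small list facts -/

/-- `exists_move_signs` with the two point sets separated pointwise instead of by thresholds. [folklore] -/
theorem exists_move_signs_sep (p q : ℝ → ℝ) (xs ys : Finset ℝ) (hxne : xs.Nonempty) (hyne : ys.Nonempty)
    (hxs : ∀ a ∈ xs, 0 < a ∧ p a ≠ 0) (hys : ∀ b ∈ ys, q b ≠ 0) (hsep : ∀ a ∈ xs, ∀ b ∈ ys, a < b) :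
    ∃ (L : ℕ) (κ : ℝ), 0 < κ ∧ (∀ a ∈ xs, 0 < (p a - κ * a ^ L * q a) * p a) ∧
      (∀ b ∈ ys, 0 < -((p b - κ * b ^ L * q b) * q b)) :=
  exists_move_signs p q xs ys (r₁ := xs.max' hxne) (r₂ := ys.min' hyne) (hxs _ (Finset.max'_mem xs hxne)).1
    (hsep _ (Finset.max'_mem xs hxne) _ (Finset.min'_mem ys hyne))
    (fun a ha => ⟨(hxs a ha).1, Finset.le_max' xs a ha, (hxs a ha).2⟩) (fun b hb => ⟨Finset.min'_le ys b hb, hys b hb⟩)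

/-- `exists_move_signs_sq` with the two point sets separated pointwise instead of by thresholds. [folklore] -/
theorem exists_move_signs_sq_sep (p q : ℝ → ℝ) (xs ys : Finset ℝ) (hxne : xs.Nonempty) (hyne : ys.Nonempty)
    (hxs : ∀ a ∈ xs, 0 < a ∧ p a ≠ 0) (hys : ∀ b ∈ ys, q b ≠ 0) (hsep : ∀ a ∈ xs, ∀ b ∈ ys, a < b) :
    ∃ (fe : ℕ) (κ : ℝ), 0 < κ ∧ (∀ a ∈ xs, 0 < (p a - κ * a ^ (2 * fe) * q a) * p a) ∧
      (∀ b ∈ ys, 0 < -((p b - κ * b ^ (2 * fe) * q b) * q b)) :=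
  exists_move_signs_sq p q xs ys (r₁ := xs.max' hxne) (r₂ := ys.min' hyne) (hxs _ (Finset.max'_mem xs hxne)).1
    (hsep _ (Finset.max'_mem xs hxne) _ (Finset.min'_mem ys hyne))
    (fun a ha => ⟨(hxs a ha).1, Finset.le_max' xs a ha, (hxs a ha).2⟩) (fun b hb => ⟨Finset.min'_le ys b hb, hys b hb⟩)

/-- in a strictly increasing list `l ++ [a]` every entry is at most `a`, and the entries of `l` are below `a`. [folklore] -/
theorem lt_last_of_isChain {l : List ℝ} {a : ℝ} (h : (l ++ [a]).IsChain (· < ·)) : ∀ u ∈ l, u < a := fun u hu =>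
  (List.pairwise_append.mp (List.isChain_iff_pairwise.mp h)).2.2 u hu a (by simp)

/-- the first entry after `M` in a strictly increasing list `M :: L` (`L ≠ []`) bounds all of `L` from below. [folklore] -/
theorem exists_head_le {M : ℝ} {L : List ℝ} (h : (M :: L).IsChain (· < ·)) (hL : L ≠ []) :
    ∃ hd : ℝ, M < hd ∧ ∀ u ∈ L, hd ≤ u := by
  obtain ⟨a, L', rfl⟩ := List.exists_cons_of_ne_nil hL
  exact ⟨a, (List.isChain_cons_cons.mp h).1, head_le_of_isChain (List.isChain_cons_cons.mp h).2⟩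

/-- replacing the head of an alternation list by a point with the same sign. [folklore] -/
theorem isChain_alt_head {φ : ℝ → ℝ} {M M' : ℝ} {L : List ℝ} (h : (M :: L).IsChain (fun u v => φ u * φ v < 0))
    (hMM' : 0 < φ M * φ M') : (M' :: L).IsChain (fun u v => φ u * φ v < 0) := by
  rw [List.isChain_cons] at h ⊢
  refine ⟨fun v hv => ?_, h.2⟩
  have := h.1 v hv
  exact mul_neg_of_sgn (t := φ M) (by linarith) this

/-- two numbers with the same sign `t` multiply to a positive number. [folklore] -/
theorem mul_pos_of_sgn {a b t : ℝ} (ha : 0 < t * a) (hb : 0 < t * b) : 0 < a * b := by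
  rcases mul_pos_iff.mp ha with ⟨ht, ha'⟩ | ⟨ht, ha'⟩
  · have hb' : 0 < b := by
      by_contra hcon; push Not at hcon; nlinarith
    exact mul_pos ha' hb'
  · have hb' : b < 0 := by
      by_contra hcon; push Not at hcon; nlinarith
    exact mul_pos_of_neg_of_neg ha' hb'

/-- membership bookkeeping for the sample list. [folklore] -/
theorem mem_full_of_left {P0 x x₁ M y y₁ P1 a : ℝ} {R T : List ℝ} (h : a ∈ P0 :: x :: x₁ :: (R ++ [M])) :
    a ∈ (P0 :: x :: x₁ :: (R ++ M :: (T ++ [y, y₁, P1]))) := by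
  simp only [List.mem_cons, List.mem_append, List.mem_nil_iff, or_false] at h ⊢; tauto

/-- membership bookkeeping for the sample list. [folklore] -/
theorem mem_full_of_right {P0 x x₁ M y y₁ P1 a : ℝ} {R T : List ℝ} (h : a ∈ M :: (T ++ [y, y₁, P1])) :
    a ∈ (P0 :: x :: x₁ :: (R ++ M :: (T ++ [y, y₁, P1]))) := by
  simp only [List.mem_cons, List.mem_append, List.mem_nil_iff, or_false] at h ⊢; tauto

/-- membership bookkeeping for the sample list. [folklore] -/
theorem mem_full_of_mid {P0 x x₁ M y y₁ P1 a : ℝ} {R T : List ℝ} (h : a ∈ x₁ :: (R ++ M :: (T ++ [y]))) :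
    a ∈ (P0 :: x :: x₁ :: (R ++ M :: (T ++ [y, y₁, P1]))) := by
  simp only [List.mem_cons, List.mem_append, List.mem_nil_iff, or_false] at h ⊢; tauto

/-- membership bookkeeping for the sample list. [folklore] -/
theorem mem_right_of_short {M' y y₁ P1 a : ℝ} {T : List ℝ} (h : a ∈ M' :: (T ++ [y])) : a ∈ M' :: (T ++ [y, y₁, P1]) := by
  simp only [List.mem_cons, List.mem_append, List.mem_nil_iff, or_false] at h ⊢; tauto

/-- membership bookkeeping for the sample list. [folklore] -/
theorem mem_left_of_short {P0 x x₁ M a : ℝ} {R : List ℝ} (h : a ∈ P0 :: x :: x₁ :: R) : a ∈ P0 :: x :: x₁ :: (R ++ [M]) := by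
  simp only [List.mem_cons, List.mem_append, List.mem_nil_iff, or_false] at h ⊢; tauto

/-! ### The harvest -/


/-- **HARVEST, orientation `ρ = 1`** (the state is in actual coordinates; `μ = −s`): one edge of type II (`X^L` vertex, `√κ·X⁰` link)
switching between the junction `M` and a fresh point `M⁺` gives `D_{k+5}` with `|R| + |T| + 4` certified alternations along
`x₁ :: R ++ M :: M⁺ :: T ++ [y]`. [mechanism: val-sym-lift-p3 g9's harvest; folklore analysis] -/
theorem pump_harvest_pos (k : ℕ) {e : ℕ → ℕ} {b : ℕ → ℝ} {f : ℕ → ℕ} {s μ P0 x x₁ M y y₁ P1 : ℝ} {R T : List ℝ}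
    (hs : μ = -s) (hP0 : 0 < P0)
    (c1 : (P0 :: x :: x₁ :: (R ++ M :: (T ++ [y, y₁, P1]))).IsChain (· < ·))
    (c2e : s * (fun z : ℝ => (((ctPath (fun t => (X : ℝ[X]) ^ e t) (fun t => C (b t) * X ^ f t) (fun t => C (b (t - 1)) * X ^ f (t - 1)) (k + 4))).det).eval (1 * z)) M < 0)
    (c2f : (M :: (T ++ [y])).IsChain (fun u v => (fun z : ℝ => (((ctPath (fun t => (X : ℝ[X]) ^ e t) (fun t => C (b t) * X ^ f t) (fun t => C (b (t - 1)) * X ^ f (t - 1)) (k + 4))).det).eval (1 * z)) u * (fun z : ℝ => (((ctPath (fun t => (X : ℝ[X]) ^ e t) (fun t => C (b t) * X ^ f t) (fun t => C (b (t - 1)) * X ^ f (t - 1)) (k + 4))).det).eval (1 * z)) v < 0))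
    (c2g : μ * (fun z : ℝ => (((ctPath (fun t => (X : ℝ[X]) ^ e t) (fun t => C (b t) * X ^ f t) (fun t => C (b (t - 1)) * X ^ f (t - 1)) (k + 4))).det).eval (1 * z)) y < 0)
    (c3c : s * (fun z : ℝ => (((ctPath (fun t => (X : ℝ[X]) ^ e t) (fun t => C (b t) * X ^ f t) (fun t => C (b (t - 1)) * X ^ f (t - 1)) (k + 3))).det).eval (1 * z)) x₁ < 0)
    (c3d : (x₁ :: (R ++ [M])).IsChain (fun u v => (fun z : ℝ => (((ctPath (fun t => (X : ℝ[X]) ^ e t) (fun t => C (b t) * X ^ f t) (fun t => C (b (t - 1)) * X ^ f (t - 1)) (k + 3))).det).eval (1 * z)) u * (fun z : ℝ => (((ctPath (fun t => (X : ℝ[X]) ^ e t) (fun t => C (b t) * X ^ f t) (fun t => C (b (t - 1)) * X ^ f (t - 1)) (k + 3))).det).eval (1 * z)) v < 0))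
    (c3e : 0 < μ * (fun z : ℝ => (((ctPath (fun t => (X : ℝ[X]) ^ e t) (fun t => C (b t) * X ^ f t) (fun t => C (b (t - 1)) * X ^ f (t - 1)) (k + 3))).det).eval (1 * z)) M)
    (c4 : (∀ z ∈ Set.Icc P0 x₁, s * (fun z : ℝ => (((ctPath (fun t => (X : ℝ[X]) ^ e t) (fun t => C (b t) * X ^ f t) (fun t => C (b (t - 1)) * X ^ f (t - 1)) (k + 3))).det).eval (1 * z)) z < 0))
    (c5 : (∀ z ∈ Set.Icc y P1, μ * (fun z : ℝ => (((ctPath (fun t => (X : ℝ[X]) ^ e t) (fun t => C (b t) * X ^ f t) (fun t => C (b (t - 1)) * X ^ f (t - 1)) (k + 4))).det).eval (1 * z)) z < 0)) :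
    ∃ (e' : ℕ → ℕ) (b' : ℕ → ℝ) (f' : ℕ → ℕ) (Λ : List ℝ),
      Λ.IsChain (· < ·) ∧ (∀ u ∈ Λ, 0 < u) ∧ R.length + T.length + 3 ≤ Λ.length ∧
      Λ.IsChain (fun u v => (((ctPath (fun t => (X : ℝ[X]) ^ e' t) (fun t => C (b' t) * X ^ f' t) (fun t => C (b' (t - 1)) * X ^ f' (t - 1)) (k + 5))).det).eval u * (((ctPath (fun t => (X : ℝ[X]) ^ e' t) (fun t => C (b' t) * X ^ f' t) (fun t => C (b' (t - 1)) * X ^ f' (t - 1)) (k + 5))).det).eval v < 0) := by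
  -- list surgery on the sample list
  have c1s : ((P0 :: x :: x₁ :: R) ++ M :: (T ++ [y, y₁, P1])).IsChain (· < ·) := c1
  have cleft : ((P0 :: x :: x₁ :: R) ++ [M]).IsChain (· < ·) := (List.isChain_split.mp c1s).1
  have cright : (M :: (T ++ [y, y₁, P1])).IsChain (· < ·) := (List.isChain_split.mp c1s).2
  have cleft' : (x₁ :: (R ++ [M])).IsChain (· < ·) :=
    (List.isChain_cons_cons.mp (List.isChain_cons_cons.mp cleft).2).2
  have hltM : ∀ u ∈ P0 :: x :: x₁ :: R, u < M := lt_last_of_isChain cleft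
  have cright' : ((M :: (T ++ [y])) ++ [y₁, P1]).IsChain (· < ·) := by simpa using cright
  have cMTy : (M :: (T ++ [y])).IsChain (· < ·) := cright'.left_of_append
  have hMlt : ∀ u ∈ T ++ [y, y₁, P1], M < u := fun u hu =>
    (List.pairwise_cons.mp (List.isChain_iff_pairwise.mp cright)).1 u hu
  have cyyP : (y :: [y₁, P1]).IsChain (· < ·) := (List.isChain_split.mp (List.isChain_cons.mp cright).2).2
  have hyy₁ : y < y₁ := (List.isChain_cons_cons.mp cyyP).1
  have hy₁P1 : y₁ < P1 := (List.isChain_cons_cons.mp (List.isChain_cons_cons.mp cyyP).2).1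
  have o1 : P0 < x := (List.isChain_cons_cons.mp c1).1
  have o2 : x < x₁ := (List.isChain_cons_cons.mp (List.isChain_cons_cons.mp c1).2).1
  have hleP1 := le_last_of_isChain c1
  -- non-vanishing facts
  have hGne : ∀ P ∈ M :: (T ++ [y, y₁, P1]), (fun z : ℝ => (((ctPath (fun t => (X : ℝ[X]) ^ e t) (fun t => C (b t) * X ^ f t) (fun t => C (b (t - 1)) * X ^ f (t - 1)) (k + 4))).det).eval (1 * z)) P ≠ 0 := by
    intro P hP
    simp only [List.mem_cons, List.mem_append, List.mem_nil_iff, or_false] at hP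
    rcases hP with hP | hP | hP | hP | hP
    · rw [hP]; intro h0; rw [h0, mul_zero] at c2e; exact lt_irrefl _ c2e
    · exact ne_zero_of_isChain_alt₂ c2f (by simp) P (by simp [hP])
    · rw [hP]; intro h0; rw [h0, mul_zero] at c2g; exact lt_irrefl _ c2g
    · rw [hP]; intro h0; have := c5 y₁ ⟨hyy₁.le, hy₁P1.le⟩; rw [h0, mul_zero] at this; exact lt_irrefl _ this
    · rw [hP]; intro h0; have := c5 P1 ⟨(hyy₁.trans hy₁P1).le, le_rfl⟩; rw [h0, mul_zero] at this; exact lt_irrefl _ this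
  have hFne : ∀ P ∈ P0 :: x :: x₁ :: (R ++ [M]), (fun z : ℝ => (((ctPath (fun t => (X : ℝ[X]) ^ e t) (fun t => C (b t) * X ^ f t) (fun t => C (b (t - 1)) * X ^ f (t - 1)) (k + 3))).det).eval (1 * z)) P ≠ 0 := by
    intro P hP
    simp only [List.mem_cons, List.mem_append, List.mem_nil_iff, or_false] at hP
    rcases hP with hP | hP | hP | hP | hP
    · rw [hP]; intro h0; have := c4 P0 ⟨le_rfl, (o1.trans o2).le⟩; rw [h0, mul_zero] at this; exact lt_irrefl _ this
    · rw [hP]; intro h0; have := c4 x ⟨o1.le, o2.le⟩; rw [h0, mul_zero] at this; exact lt_irrefl _ this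
    · rw [hP]; intro h0; rw [h0, mul_zero] at c3c; exact lt_irrefl _ c3c
    · exact ne_zero_of_isChain_alt₂ c3d (by simp) P (by simp [hP])
    · rw [hP]; intro h0; rw [h0, mul_zero] at c3e; exact lt_irrefl _ c3e
  have hFc := continuous_eval_det_epath e b f (k + 3) 1
  have hGc := continuous_eval_det_epath e b f (k + 4) 1
  obtain ⟨hd, hMhd, hhd⟩ := exists_head_le cright (by simp)
  obtain ⟨Mp, ⟨hMMp, hMphd⟩, hGMp, -⟩ := exists_point_right₂ hGc hFc (s := -s) (t := μ) hMhd (by linarith [c2e]) c3e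
  obtain ⟨L, κ', hκ', hl, hr⟩ := exists_move_signs_sep (fun z : ℝ => (((ctPath (fun t => (X : ℝ[X]) ^ e t) (fun t => C (b t) * X ^ f t) (fun t => C (b (t - 1)) * X ^ f (t - 1)) (k + 3))).det).eval (1 * z)) (fun z : ℝ => (((ctPath (fun t => (X : ℝ[X]) ^ e t) (fun t => C (b t) * X ^ f t) (fun t => C (b (t - 1)) * X ^ f (t - 1)) (k + 4))).det).eval (1 * z))
    (P0 :: x :: x₁ :: (R ++ [M])).toFinset (Mp :: (T ++ [y, y₁, P1])).toFinset ⟨P0, by simp⟩ ⟨Mp, by simp⟩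
    (fun a ha => by
      rw [List.mem_toFinset] at ha
      exact ⟨by linarith [head_le_of_isChain c1 a (mem_full_of_left ha)], hFne a ha⟩)
    (fun u hu => by
      rw [List.mem_toFinset, List.mem_cons] at hu
      rcases hu with hu | hu
      · rw [hu]; intro h0; rw [h0, mul_zero] at hGMp; exact lt_irrefl _ hGMp
      · exact hGne u (by simp only [List.mem_cons]; exact Or.inr hu))
    (fun a ha u hu => by
      rw [List.mem_toFinset] at ha hu
      have haM : a ≤ M := by
        have ha' : a ∈ (P0 :: x :: x₁ :: R) ++ [M] := by simpa using ha
        rcases List.mem_append.mp ha' with ha' | ha'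
        · exact (hltM a ha').le
        · rw [List.mem_singleton.mp ha']
      rcases List.mem_cons.mp hu with hu | hu
      · rw [hu]; linarith
      · linarith [hhd u hu])
  -- the harvested continuant
  obtain ⟨e', he'⟩ : ∃ e' : ℕ → ℕ, e' = fun t => if t < k + 4 then e t else L := ⟨_, rfl⟩
  obtain ⟨b', hb'⟩ : ∃ b' : ℕ → ℝ, b' = fun t => if t < k + 3 then b t else Real.sqrt (1 / κ') := ⟨_, rfl⟩
  obtain ⟨f', hf'⟩ : ∃ f' : ℕ → ℕ, f' = fun t => if t < k + 3 then f t else 0 := ⟨_, rfl⟩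
  have hagree : ∀ n, n ≤ k + 4 → (ctPath (fun t => (X : ℝ[X]) ^ e' t) (fun t => C (b' t) * X ^ f' t) (fun t => C (b' (t - 1)) * X ^ f' (t - 1)) n) = (ctPath (fun t => (X : ℝ[X]) ^ e t) (fun t => C (b t) * X ^ f t) (fun t => C (b (t - 1)) * X ^ f (t - 1)) n) := by
    intro n hn
    refine ctPath_congr_edata (fun t ht => ?_) (fun t ht => ?_) (fun t ht => ?_)
    · rw [he']; simp only [show t < k + 4 by omega, if_true]
    · rw [hb']; simp only [show t < k + 3 by omega, if_true]
    · rw [hf']; simp only [show t < k + 3 by omega, if_true]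
  have hD5 : ∀ u : ℝ, (((ctPath (fun t => (X : ℝ[X]) ^ e' t) (fun t => C (b' t) * X ^ f' t) (fun t => C (b' (t - 1)) * X ^ f' (t - 1)) (k + 5))).det).eval u =
      u ^ L * (((ctPath (fun t => (X : ℝ[X]) ^ e t) (fun t => C (b t) * X ^ f t) (fun t => C (b (t - 1)) * X ^ f (t - 1)) (k + 4))).det).eval u - 1 / κ' * (((ctPath (fun t => (X : ℝ[X]) ^ e t) (fun t => C (b t) * X ^ f t) (fun t => C (b (t - 1)) * X ^ f (t - 1)) (k + 3))).det).eval u := by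
    intro u
    have h := eval_det_epath_add_two e' b' f' (k + 3) u
    have h1 : e' (k + 3 + 1) = L := by rw [he']; simp
    have h2 : b' (k + 3) ^ 2 = 1 / κ' := by
      rw [hb']; simp only [lt_irrefl, if_false]; exact Real.sq_sqrt (by positivity)
    have h3 : f' (k + 3) = 0 := by rw [hf']; simp
    have h4 : (((ctPath (fun t => (X : ℝ[X]) ^ e' t) (fun t => C (b' t) * X ^ f' t) (fun t => C (b' (t - 1)) * X ^ f' (t - 1)) (k + 3 + 1))).det).eval u = (((ctPath (fun t => (X : ℝ[X]) ^ e t) (fun t => C (b t) * X ^ f t) (fun t => C (b (t - 1)) * X ^ f (t - 1)) (k + 4))).det).eval u := by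
      rw [hagree _ (by omega)]
    have h5 : (((ctPath (fun t => (X : ℝ[X]) ^ e' t) (fun t => C (b' t) * X ^ f' t) (fun t => C (b' (t - 1)) * X ^ f' (t - 1)) (k + 3))).det).eval u = (((ctPath (fun t => (X : ℝ[X]) ^ e t) (fun t => C (b t) * X ^ f t) (fun t => C (b (t - 1)) * X ^ f (t - 1)) (k + 3))).det).eval u := by
      rw [hagree _ (by omega)]
    rw [h1, h2, h3, h4, h5, mul_zero, pow_zero, mul_one] at h
    exact h
  -- signs of the harvested continuant: `−F` on the left block (incl. `M`), `G` from `M⁺` on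
  have sL : ∀ a ∈ P0 :: x :: x₁ :: (R ++ [M]), 0 < (-1) * ((fun z : ℝ => (((ctPath (fun t => (X : ℝ[X]) ^ e t) (fun t => C (b t) * X ^ f t) (fun t => C (b (t - 1)) * X ^ f (t - 1)) (k + 3))).det).eval (1 * z)) a * (((ctPath (fun t => (X : ℝ[X]) ^ e' t) (fun t => C (b' t) * X ^ f' t) (fun t => C (b' (t - 1)) * X ^ f' (t - 1)) (k + 5))).det).eval a) := by
    intro a ha
    have := hl a (List.mem_toFinset.mpr ha)
    rw [hD5]
    have e1 : (-1) * ((fun z : ℝ => (((ctPath (fun t => (X : ℝ[X]) ^ e t) (fun t => C (b t) * X ^ f t) (fun t => C (b (t - 1)) * X ^ f (t - 1)) (k + 3))).det).eval (1 * z)) a * (a ^ L * (((ctPath (fun t => (X : ℝ[X]) ^ e t) (fun t => C (b t) * X ^ f t) (fun t => C (b (t - 1)) * X ^ f (t - 1)) (k + 4))).det).eval a - 1 / κ' * (((ctPath (fun t => (X : ℝ[X]) ^ e t) (fun t => C (b t) * X ^ f t) (fun t => C (b (t - 1)) * X ^ f (t - 1)) (k + 3))).det).eval a)) =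
        (1 / κ') * (((((ctPath (fun t => (X : ℝ[X]) ^ e t) (fun t => C (b t) * X ^ f t) (fun t => C (b (t - 1)) * X ^ f (t - 1)) (k + 3))).det).eval (1 * a) - κ' * a ^ L * (((ctPath (fun t => (X : ℝ[X]) ^ e t) (fun t => C (b t) * X ^ f t) (fun t => C (b (t - 1)) * X ^ f (t - 1)) (k + 4))).det).eval (1 * a)) * (((ctPath (fun t => (X : ℝ[X]) ^ e t) (fun t => C (b t) * X ^ f t) (fun t => C (b (t - 1)) * X ^ f (t - 1)) (k + 3))).det).eval (1 * a)) := by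
      simp only [one_mul]; field_simp; ring
    rw [e1]; positivity
  have sR : ∀ u ∈ Mp :: (T ++ [y, y₁, P1]), 0 < 1 * ((fun z : ℝ => (((ctPath (fun t => (X : ℝ[X]) ^ e t) (fun t => C (b t) * X ^ f t) (fun t => C (b (t - 1)) * X ^ f (t - 1)) (k + 4))).det).eval (1 * z)) u * (((ctPath (fun t => (X : ℝ[X]) ^ e' t) (fun t => C (b' t) * X ^ f' t) (fun t => C (b' (t - 1)) * X ^ f' (t - 1)) (k + 5))).det).eval u) := by
    intro u hu
    have := hr u (List.mem_toFinset.mpr hu)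
    rw [hD5]
    have e1 : 1 * ((fun z : ℝ => (((ctPath (fun t => (X : ℝ[X]) ^ e t) (fun t => C (b t) * X ^ f t) (fun t => C (b (t - 1)) * X ^ f (t - 1)) (k + 4))).det).eval (1 * z)) u * (u ^ L * (((ctPath (fun t => (X : ℝ[X]) ^ e t) (fun t => C (b t) * X ^ f t) (fun t => C (b (t - 1)) * X ^ f (t - 1)) (k + 4))).det).eval u - 1 / κ' * (((ctPath (fun t => (X : ℝ[X]) ^ e t) (fun t => C (b t) * X ^ f t) (fun t => C (b (t - 1)) * X ^ f (t - 1)) (k + 3))).det).eval u)) =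
        (1 / κ') * -(((((ctPath (fun t => (X : ℝ[X]) ^ e t) (fun t => C (b t) * X ^ f t) (fun t => C (b (t - 1)) * X ^ f (t - 1)) (k + 3))).det).eval (1 * u) - κ' * u ^ L * (((ctPath (fun t => (X : ℝ[X]) ^ e t) (fun t => C (b t) * X ^ f t) (fun t => C (b (t - 1)) * X ^ f (t - 1)) (k + 4))).det).eval (1 * u)) * (((ctPath (fun t => (X : ℝ[X]) ^ e t) (fun t => C (b t) * X ^ f t) (fun t => C (b (t - 1)) * X ^ f (t - 1)) (k + 4))).det).eval (1 * u)) := by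
      simp only [one_mul]; field_simp; ring
    rw [e1]; positivity
  refine ⟨e', b', f', x₁ :: (R ++ M :: Mp :: (T ++ [y])), ?_, ?_, by simp; omega, ?_⟩
  · -- strictly increasing
    have e1 : x₁ :: (R ++ M :: Mp :: (T ++ [y])) = (x₁ :: R) ++ M :: Mp :: (T ++ [y]) := rfl
    rw [e1, List.isChain_split]
    refine ⟨cleft', List.isChain_cons_cons.mpr ⟨hMMp, List.isChain_iff_pairwise.mpr (List.pairwise_cons.mpr ⟨fun u hu => ?_, ?_⟩)⟩⟩
    · exact lt_of_lt_of_le hMphd (hhd u (by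
        rw [show T ++ [y, y₁, P1] = (T ++ [y]) ++ [y₁, P1] by simp]; exact List.mem_append_left _ hu))
    · exact List.isChain_iff_pairwise.mp (List.isChain_cons.mp cMTy).2
  · -- positive
    intro u hu
    have hx₁ : 0 < x₁ := hP0.trans (o1.trans o2)
    simp only [List.mem_cons, List.mem_append, List.mem_nil_iff, or_false] at hu
    rcases hu with hu | hu | hu | hu | hu | hu
    · rw [hu]; exact hx₁
    · linarith [head_le_of_isChain cleft' u (by simp [hu])]
    · rw [hu]; linarith [hltM x₁ (by simp)]
    · rw [hu]; linarith [hltM x₁ (by simp)]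
    · linarith [hMlt u (by simp [hu]), hltM x₁ (by simp)]
    · rw [hu]; linarith [hMlt y (by simp), hltM x₁ (by simp)]
  · -- alternation: `−F` alternates along `x₁ … M`, then the transition zero before `M⁺`, then `G` alternates along `M⁺ … y`
    have e1 : x₁ :: (R ++ M :: Mp :: (T ++ [y])) = (x₁ :: R) ++ M :: Mp :: (T ++ [y]) := rfl
    rw [e1, List.isChain_split]
    constructor
    · refine (isChain_alt_congr (c := -1) ?_).mp c3d
      intro a ha
      exact sL a (List.mem_cons_of_mem _ (List.mem_cons_of_mem _ ha))
    · have hFM : 0 < (-s) * (fun z : ℝ => (((ctPath (fun t => (X : ℝ[X]) ^ e t) (fun t => C (b t) * X ^ f t) (fun t => C (b (t - 1)) * X ^ f (t - 1)) (k + 3))).det).eval (1 * z)) M := by rw [← hs]; exact c3e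
      have h1 : (fun z : ℝ => (((ctPath (fun t => (X : ℝ[X]) ^ e t) (fun t => C (b t) * X ^ f t) (fun t => C (b (t - 1)) * X ^ f (t - 1)) (k + 3))).det).eval (1 * z)) M * (((ctPath (fun t => (X : ℝ[X]) ^ e' t) (fun t => C (b' t) * X ^ f' t) (fun t => C (b' (t - 1)) * X ^ f' (t - 1)) (k + 5))).det).eval M < 0 := by
        have := sL M (by simp); linarith
      have hφM : 0 < s * (((ctPath (fun t => (X : ℝ[X]) ^ e' t) (fun t => C (b' t) * X ^ f' t) (fun t => C (b' (t - 1)) * X ^ f' (t - 1)) (k + 5))).det).eval M := by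
        have := sgn_of_mul_neg (a := (((ctPath (fun t => (X : ℝ[X]) ^ e' t) (fun t => C (b' t) * X ^ f' t) (fun t => C (b' (t - 1)) * X ^ f' (t - 1)) (k + 5))).det).eval M) (b := (fun z : ℝ => (((ctPath (fun t => (X : ℝ[X]) ^ e t) (fun t => C (b t) * X ^ f t) (fun t => C (b (t - 1)) * X ^ f (t - 1)) (k + 3))).det).eval (1 * z)) M) (t := -s)
          (by linarith [mul_comm ((fun z : ℝ => (((ctPath (fun t => (X : ℝ[X]) ^ e t) (fun t => C (b t) * X ^ f t) (fun t => C (b (t - 1)) * X ^ f (t - 1)) (k + 3))).det).eval (1 * z)) M) ((((ctPath (fun t => (X : ℝ[X]) ^ e' t) (fun t => C (b' t) * X ^ f' t) (fun t => C (b' (t - 1)) * X ^ f' (t - 1)) (k + 5))).det).eval M)]) hFM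
        linarith
      have h2 : 0 < (fun z : ℝ => (((ctPath (fun t => (X : ℝ[X]) ^ e t) (fun t => C (b t) * X ^ f t) (fun t => C (b (t - 1)) * X ^ f (t - 1)) (k + 4))).det).eval (1 * z)) Mp * (((ctPath (fun t => (X : ℝ[X]) ^ e' t) (fun t => C (b' t) * X ^ f' t) (fun t => C (b' (t - 1)) * X ^ f' (t - 1)) (k + 5))).det).eval Mp := by
        have := sR Mp (by simp); linarith
      have hφMp : 0 < (-s) * (((ctPath (fun t => (X : ℝ[X]) ^ e' t) (fun t => C (b' t) * X ^ f' t) (fun t => C (b' (t - 1)) * X ^ f' (t - 1)) (k + 5))).det).eval Mp :=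
        sgn_of_mul_pos (a := (((ctPath (fun t => (X : ℝ[X]) ^ e' t) (fun t => C (b' t) * X ^ f' t) (fun t => C (b' (t - 1)) * X ^ f' (t - 1)) (k + 5))).det).eval Mp) (b := (fun z : ℝ => (((ctPath (fun t => (X : ℝ[X]) ^ e t) (fun t => C (b t) * X ^ f t) (fun t => C (b (t - 1)) * X ^ f (t - 1)) (k + 4))).det).eval (1 * z)) Mp)
          (by linarith [mul_comm ((fun z : ℝ => (((ctPath (fun t => (X : ℝ[X]) ^ e t) (fun t => C (b t) * X ^ f t) (fun t => C (b (t - 1)) * X ^ f (t - 1)) (k + 4))).det).eval (1 * z)) Mp) ((((ctPath (fun t => (X : ℝ[X]) ^ e' t) (fun t => C (b' t) * X ^ f' t) (fun t => C (b' (t - 1)) * X ^ f' (t - 1)) (k + 5))).det).eval Mp)]) hGMp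
      have hGG : 0 < (fun z : ℝ => (((ctPath (fun t => (X : ℝ[X]) ^ e t) (fun t => C (b t) * X ^ f t) (fun t => C (b (t - 1)) * X ^ f (t - 1)) (k + 4))).det).eval (1 * z)) M * (fun z : ℝ => (((ctPath (fun t => (X : ℝ[X]) ^ e t) (fun t => C (b t) * X ^ f t) (fun t => C (b (t - 1)) * X ^ f (t - 1)) (k + 4))).det).eval (1 * z)) Mp := mul_pos_of_sgn (t := -s) (by linarith [c2e]) hGMp
      refine List.isChain_cons_cons.mpr ⟨mul_neg_of_sgn (t := s) hφM (by linarith), ?_⟩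
      refine (isChain_alt_congr (c := 1) ?_).mp (isChain_alt_head c2f (M' := Mp) hGG)
      intro u hu
      exact sR u (mem_right_of_short hu)

end Summit.ValiantsHypothesis.ValiantsHypothesis.Theorems.KPlusLogSqLaw.StaticTridiagonalRealLadder
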